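import Literature.IUT.HodgeArakelov.FlSymmetryNonVacuity
import Literature.IUT.HodgeArakelov.ThetaQuotientDataNonVacuity
import Literature.IUT.HodgeTheaters.DiscreteProfiniteCompletionsProofs
import HarnessLib

/-!
# [IUTchII] Rmk 1.1.1 (iv) at the [EtTh] model: `Π_M|_{(l·Δ_Θ)(M)}` IS ABELIAN — the first structural clause of
# `FlSymmetry.nonempty_iff` DISCHARGED for the model theta quotient

S. Mochizuki, *Inter-universal Teichmüller theory II*, §1, Remark 1.1.1 (iv), kurims manuscript (Dec. 2020)
p. 23: "the abelian profinite group `Π_μ(M) ⋊ (l·Δ_Θ)(M)`" (`= Π_M|_{(l·Δ_Θ)(M)}`)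
[cite: Mochizuki2012, Rmk 1.1.1 (iv) p.23] [claim: Mochizuki2012, status: disputed].

PROOF-ONLY file (abc-iut cell, wave-5 prover abc-iut-w5-d219 gen 2; continuation of the NV-L6 row «FlSymmetry»,
`FlSymmetryNonVacuity.lean` p419429). No `def`/`instance`/`structure`.

`FlSymmetry.nonempty_iff` (p419429) reduces the inhabitation of the Rmk 1.1.1 (iv) record `FlSymmetry Sec` over
`(R, T, W, Sec)` to three structural clauses; the first — «`Π_M|_{(l·Δ_Θ)(M)}` (the subquotient
`T.envAtTheta.carrier`) is abelian» — depends on `(R, T)` only. abc-iut-w4-d030's `ThetaQuotientDataNonVacuity.lean`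
(p419484/p419913) constructs the GENUINE theta-quotient data over the Def. 1.1 (i) output `F.reconstruction e` of every
[EtTh] model frame (`F : ModelFrame S R`, `e : Π_M ≃ Π^tp_{Y̲̲}[μ_N]`), with `thetaSection := e⁻¹(s^alg(thetaKer))`.
This file PROVES the abelian clause for every such `T`:

* `ModelFrame.commutator_mem_thetaKer` — commutators of `l·Δ_Θ` (its inverse image in `Π^tp_X`) lie in
  `thetaKer`, because `(l·Δ_Θ)/thetaKer ≅ Ẑ` (frame field `int_iso_ZHat`) is commutative
  (`Literature.IUT.HodgeTheaters.ZHat.mul_comm`);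
* `ModelFrame.env_commutator_eq_algSection` — inside `Π^tp_{Y̲̲}[μ_N] = μ_N ⋊_{χ∘aug} Π^tp_{Y̲̲}`, for `x, y`
  lying over `l·Δ_Θ ⊆ Δ = Ker(aug)` the cyclotomic character acts trivially, so
  `[x, y] = s^alg([x̄, ȳ])` with `[x̄, ȳ] ∈ thetaKer` (`μ_N` commutative);
* `ModelFrame.envAtTheta_mul_comm` — hence, for every `T : ThetaQuotientData (F.reconstruction e)` whose theta
  section is the model one, `T.envAtTheta.carrier` is COMMUTATIVE;
* `ModelFrame.exists_thetaQuotientData_model_comm` — the `∃`-form of w4-d030's witness with the abelian clause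
  appended; `EtaleLevels.exists_thetaQuotientData_model_comm` at every level of the natural system of `X̲̲_K`;
* `ModelFrame.flSymmetry_nonempty_of_coreTower` — consequently, at the model `T`, `FlSymmetry Sec` is inhabited
  for every core tower `W` and two-sections datum `Sec` as soon as the two `W`-clauses hold
  (`Δ_X(M) ⊴ Δ_C(M)`, `Δ_C(M)/Δ_X(M) ≅ 𝔽_l^{⋊±}`): the remaining obligations of the FlSymmetry row sit on the
  CoreTower row alone.

HONEST FRAMING: kernel facts about the cell's own model objects ([EtTh] interface `RigidData` + B8 frames); nothing
of [IUTchII] is asserted; no side taken on [IUTchIII] Cor. 3.12; typed ≠ discharged.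
-/

namespace Literature.IUT.HodgeArakelov

open Literature.AnabelianGeometry.EtaleTheta

universe u

noncomputable section

namespace ModelFrame

open ModelCyclotomes

variable {S : ThetaSetting.{u}} {l : ℕ} {R : RigidData.{u} S.N l}

/-- **Commutators of `l·Δ_Θ` lie in `thetaKer`**: `(l·Δ_Θ)/thetaKer ≅ Ẑ` (the frame's `int_iso_ZHat`) is
commutative. [cite: MochizukiEtTh2009, §1 p.12] -/
theorem commutator_mem_thetaKer (F : ModelFrame S R) {g h : R.PiX} (hg : g ∈ R.lDeltaTheta)
    (hh : h ∈ R.lDeltaTheta) : g * h * g⁻¹ * h⁻¹ ∈ R.thetaKer := by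
  obtain ⟨ι⟩ := F.int_iso_ZHat
  have hcomm : ∀ a b : lDeltaQuot R, a * b = b * a := fun a b =>
    ι.injective (by rw [map_mul, map_mul]; exact Literature.IUT.HodgeTheaters.ZHat.mul_comm _ _)
  have h1 : ((QuotientGroup.mk (⟨g, hg⟩ * ⟨h, hh⟩ * ⟨g, hg⟩⁻¹ * ⟨h, hh⟩⁻¹ : ↥R.lDeltaTheta)) :
      lDeltaQuot R) = 1 := by
    rw [QuotientGroup.mk_mul, QuotientGroup.mk_mul, QuotientGroup.mk_mul, QuotientGroup.mk_inv,
      QuotientGroup.mk_inv, hcomm (QuotientGroup.mk ⟨g, hg⟩) (QuotientGroup.mk ⟨h, hh⟩)]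
    group
  rw [QuotientGroup.eq_one_iff, Subgroup.mem_subgroupOf] at h1
  exact h1

/-- On `Π^tp_{Y̲̲}`-elements lying in `Δ = Ker(aug)` the cyclotomic character `χ ∘ aug` is trivial.
[cite: MochizukiEtTh2009, Def 2.13 p.47] -/
theorem chi_augY_eq_one_of_mem_ker {y : ↥R.PiY} (hy : (y : R.PiX) ∈ R.aug.ker) :
    (R.chi.comp R.augY) y = 1 := by
  rw [MonoidHom.mem_ker] at hy
  change R.chi (R.aug (y : R.PiX)) = 1
  rw [hy, map_one]

/-- **Commutators in `Π^tp_{Y̲̲}[μ_N] = μ_N ⋊ Π^tp_{Y̲̲}` over `l·Δ_Θ`**: for `x, y` with `x̄, ȳ ∈ l·Δ_Θ` (`⊆ Δ`, so the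
character acts trivially and the `μ_N`-components cancel, `μ_N` being commutative), the commutator is the algebraic
section of `[x̄, ȳ]`. [cite: MochizukiEtTh2009, Def 2.13 p.47] -/
theorem env_commutator_eq_algSection (x y : R.env) (hx : ((x.right : ↥R.PiY) : R.PiX) ∈ R.lDeltaTheta)
    (hy : ((y.right : ↥R.PiY) : R.PiX) ∈ R.lDeltaTheta) :
    x * y * x⁻¹ * y⁻¹ =
      CycEnvelope.algSection R.augY R.chi (x.right * y.right * x.right⁻¹ * y.right⁻¹) := by
  -- every `Π^tp_{Y̲̲}`-component met below lies in `Δ = Ker(aug)`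
  have hxk : ((x.right : ↥R.PiY) : R.PiX) ∈ R.aug.ker := (R.lDeltaTheta_le hx).2
  have hyk : ((y.right : ↥R.PiY) : R.PiX) ∈ R.aug.ker := (R.lDeltaTheta_le hy).2
  have hK : ∀ z : ↥R.PiY, (z : R.PiX) ∈ R.aug.ker → (R.chi.comp R.augY) z = 1 :=
    fun z hz => chi_augY_eq_one_of_mem_ker hz
  have e1 : (R.chi.comp R.augY) x.right = 1 := hK _ hxk
  have e2 : (R.chi.comp R.augY) y.right = 1 := hK _ hyk
  have e3 : (R.chi.comp R.augY) x.right⁻¹ = 1 := by rw [map_inv, e1, inv_one]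
  have e4 : (R.chi.comp R.augY) y.right⁻¹ = 1 := by rw [map_inv, e2, inv_one]
  have e5 : (R.chi.comp R.augY) (x.right * y.right) = 1 := by rw [map_mul, e1, e2, mul_one]
  have e6 : (R.chi.comp R.augY) (x.right * y.right * x.right⁻¹) = 1 := by rw [map_mul, e5, e3, mul_one]
  apply SemidirectProduct.ext
  · simp only [SemidirectProduct.mul_left, SemidirectProduct.mul_right, SemidirectProduct.inv_left,
      SemidirectProduct.inv_right, e3, e4, e5, e6, e1, MulAut.one_apply, SemidirectProduct.left_inr]
    rw [mul_right_comm x.left y.left x.left⁻¹, mul_inv_cancel, one_mul, mul_inv_cancel]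
  · simp only [SemidirectProduct.mul_right, SemidirectProduct.inv_right, SemidirectProduct.right_inr]

/-- **`Π_M|_{(l·Δ_Θ)(M)}` is abelian at the model** ([IUTchII] Rmk 1.1.1 (iv) p. 23 «the abelian profinite group
`Π_μ(M) ⋊ (l·Δ_Θ)(M)`»): for every [EtTh] model frame `F`, identification `e : Π_M ≃ Π^tp_{Y̲̲}[μ_N]`, and every
theta-quotient datum `T` over `F.reconstruction e` whose theta section is the model one
`e⁻¹(s^alg(thetaKer))` (abc-iut-w4-d030's witness), the subquotient `T.envAtTheta.carrier` is commutative.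
[cite: Mochizuki2012, Rmk 1.1.1 (iv) p.23] -/
theorem envAtTheta_mul_comm (F : ModelFrame S R) {M : MonoThetaEnv S} (e : M.Pi ≃ₜ* R.env)
    (T : ThetaQuotientData (F.reconstruction e))
    (hT : T.thetaSection =
      ((R.thetaKer.subgroupOf R.PiY).map (CycEnvelope.algSection R.augY R.chi)).comap e.toMulEquiv.toMonoidHom)
    (a b : T.envAtTheta.carrier) : a * b = b * a := by
  -- commutators of the top subgroup lie in the theta section
  have key : ∀ u v : M.Pi, u ∈ T.envAtTheta.top → v ∈ T.envAtTheta.top → u * v * u⁻¹ * v⁻¹ ∈ T.thetaSection := by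
    intro u v hu hv
    have hu' : (((e u).right : ↥R.PiY) : R.PiX) ∈ R.lDeltaTheta := hu
    have hv' : (((e v).right : ↥R.PiY) : R.PiX) ∈ R.lDeltaTheta := hv
    rw [hT, Subgroup.mem_comap]
    change e (u * v * u⁻¹ * v⁻¹) ∈ _
    rw [map_mul, map_mul, map_mul, map_inv, map_inv, env_commutator_eq_algSection (e u) (e v) hu' hv']
    refine Subgroup.mem_map.2 ⟨(e u).right * (e v).right * (e u).right⁻¹ * (e v).right⁻¹, ?_, rfl⟩
    rw [Subgroup.mem_subgroupOf]
    push_cast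
    exact commutator_mem_thetaKer F hu' hv'
  induction a using QuotientGroup.induction_on with
  | H u =>
    induction b using QuotientGroup.induction_on with
    | H v =>
      rw [← QuotientGroup.mk_mul, ← QuotientGroup.mk_mul, QuotientGroup.eq, Subgroup.mem_subgroupOf]
      change _ ∈ T.thetaSection
      have h := key (v : M.Pi)⁻¹ (u : M.Pi)⁻¹ (inv_mem v.2) (inv_mem u.2)
      simp only [inv_inv] at h
      simpa [mul_assoc] using h

/-- **w4-d030's model witness WITH the abelian clause**: over every frame there is a theta-quotient datum with the
model defining equations, `Π_μ(M) ∩ s^Θ|_{Ker} = 1`, and ABELIAN `Π_M|_{(l·Δ_Θ)(M)}`.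
[cite: Mochizuki2012, Rmk 1.1.1 (ii) p.22; (iv) p.23] -/
theorem exists_thetaQuotientData_model_comm (F : ModelFrame S R) {M : MonoThetaEnv S} (e : M.Pi ≃ₜ* R.env) :
    ∃ T : ThetaQuotientData (F.reconstruction e),
      T.kerTheta = R.thetaKer.subgroupOf R.PiY ∧
      T.thetaSection =
        ((R.thetaKer.subgroupOf R.PiY).map (CycEnvelope.algSection R.augY R.chi)).comap e.toMulEquiv.toMonoidHom ∧
      (F.reconstruction e).extCyc ⊓ T.thetaSection = ⊥ ∧
      ∀ a b : T.envAtTheta.carrier, a * b = b * a := by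
  obtain ⟨T, h1, h2, h3⟩ := exists_thetaQuotientData_model F e
  exact ⟨T, h1, h2, h3, envAtTheta_mul_comm F e T h2⟩

/-- **`FlSymmetry` at the model: only the CoreTower clauses remain.** For the model theta-quotient datum `T` (theta
section `e⁻¹(s^alg(thetaKer))`), every core tower `W` over `F.reconstruction e` with `Δ_X(M) ⊴ Δ_C(M)` and
`Δ_C(M)/Δ_X(M) ≅ 𝔽_l^{⋊±}`, and every two-sections datum `Sec : TwoSections T W`, the Rmk 1.1.1 (iv) record
`FlSymmetry Sec` is inhabited (`FlSymmetry.nonempty_of` with the abelian clause discharged here; degenerate action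
data as labelled there). [cite: Mochizuki2012, Rmk 1.1.1 (iv) pp.23-24] -/
theorem flSymmetry_nonempty_of_coreTower (F : ModelFrame S R) {M : MonoThetaEnv S} (e : M.Pi ≃ₜ* R.env)
    (T : ThetaQuotientData (F.reconstruction e))
    (hT : T.thetaSection =
      ((R.thetaKer.subgroupOf R.PiY).map (CycEnvelope.algSection R.augY R.chi)).comap e.toMulEquiv.toMonoidHom)
    (W : CoreTower (F.reconstruction e)) (Sec : TwoSections T W)
    (hN : (W.DeltaXplain.subgroupOf W.DeltaC).Normal)
    (hq : Nonempty (W.DeltaC ⧸ W.DeltaXplain.subgroupOf W.DeltaC ≃* Literature.IUT.HodgeTheaters.FlPM S.l)) :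
    Nonempty (FlSymmetry Sec) :=
  FlSymmetry.nonempty_of Sec (envAtTheta_mul_comm F e T hT) hN hq

end ModelFrame

/-! ### At every level of the natural system of `X̲̲_K` (B8 part 5c) -/

namespace EtaleLevels

open Literature.AnabelianGeometry.SemiGraphs
open scoped Literature.AnabelianGeometry.EtaleTheta

variable {p : ℕ} [Fact p.Prime] {D : Literature.AnabelianGeometry.EtaleTheta.ThetaSetting p}
  {E : D.EtaleThetaData} {l : ℕ} (C : E.DoubleUnderline l) (hC : D.Compat) (hS : D.Sec2Hyps)
  (hl : l.Prime) (hp2 : p ≠ 2) (hpl : p ≠ l) (hζ : ∃ ζ : D.K, IsPrimitiveRoot ζ (4 * l))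
  (mods : ∀ M : ℕ+, D.CyclotomeMod l M)
  (f : contCocycles D.toTheta D.DeltaTheta C.GtpYdduu) (hf : f ∈ C.rootCocycles hC)
  (h15 : Literature.AnabelianGeometry.EtaleTheta.ThetaSetting.Prop15iii E hC) (L : C.CuspLabels)
  (hZ : ∀ M : ℕ+, Nonempty (ModelCyclotomes.lDeltaQuot (C.rigidData (mods M) hC hS h15 L) ≃*
    Literature.IUT.HodgeTheaters.ZHat))

/-- **At every level `M` of the natural system of `X̲̲_K`**: the Def. 1.1 (i) output of the model mono-theta
environment `𝕄_M` carries theta-quotient data (abc-iut-w4-d030) whose subquotient `Π_M|_{(l·Δ_Θ)(M)}` is ABELIAN.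
[cite: Mochizuki2012, Rmk 1.1.1 (iv) p.23] -/
theorem exists_thetaQuotientData_model_comm (M : ℕ+) :
    ∃ T : ThetaQuotientData (modelRecon C hC hS hl hp2 hpl hζ mods f hf h15 L hZ M),
      (modelRecon C hC hS hl hp2 hpl hζ mods f hf h15 L hZ M).extCyc ⊓ T.thetaSection = ⊥ ∧
      ∀ a b : T.envAtTheta.carrier, a * b = b * a := by
  unfold modelRecon
  obtain ⟨T, -, -, h3, h4⟩ := ModelFrame.exists_thetaQuotientData_model_comm
    (M := (modelFamily C hC hS hl hp2 hpl hζ mods f hf).modelEnv M)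
    (modelFrame C hC hS hl hp2 hpl hζ mods f hf h15 L hZ M) (ContinuousMulEquiv.refl _)
  exact ⟨T, h3, h4⟩

end EtaleLevels

end

end Literature.IUT.HodgeArakelov
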